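import Literature.MathematicalPhysics.QuantumFieldTheory.Balaban1983to89.B5TowerOneStroke
import Literature.MathematicalPhysics.QuantumFieldTheory.Balaban1983to89.B5Eq165DeltaK
import Literature.MathematicalPhysics.QuantumFieldTheory.Balaban1983to89.B5Eq115GaugeChain
import Literature.MathematicalPhysics.QuantumFieldTheory.Balaban1983to89.B6Cov2156TorusDelK

/-!
# `Balaban1983to89.B5Eq166GaussDeltaK` — T. Bałaban, *Propagators and renormalization transformations for lattice
gauge theories. I*, Commun. Math. Phys. **95** (1984) 17–40 [Balaban1984PropagatorsI], (1.19) p. 20, (1.64)–(1.67)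
p. 29, (1.102)–(1.103) p. 34: **THE `Δ_k` DEFINED BY THE k-FOLD RENORMALIZATION INTEGRAL (1.17)/(1.19) IS THE
OPERATOR OF (1.65)/(1.66)** — for the B5 owner's Gaussian covariance `B5Eq114Gauss.DeltaK L M k = W_k†W_k` and the
tree's (1.65) operator `Beta.BlockEffectiveAction.DelK (L^k) = n^{−d}H_kᴴ(∂*∂)H_k = (Q_kGQ_k*)⁻¹ − a`:
`cplx (Δ_k B) = DelK (L^k) *ᵥ cplx B` for every `k` and every real field `B`, whence (1.66) and (1.67) for THIS `Δ_k`

statement-level skeleton of published theorems with citation tags; proofs where landed; nothing here is a claim about the Yang–Mills mass gap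

PDF held: `paper:balaban1984-cmp95-propagators-rt-i` (journal page = PDF page + 16); pages READ AS IMAGES by this seat:
renders `run/shared/lean/pub/pub-balaban/b2b-balaban-ref1/pages/1984-cmp95-propagators-rt-I/…-p004-x2.png` (p. 20:
(1.17)–(1.20)), `…-p013-x2.png` (p. 29: (1.64)–(1.67), (1.69)), `…-p018-x2.png` (p. 34: (1.99)–(1.103)).

CITATION HEADER (lean-in-tree rule).  Cell `lit-balaban` (HOME `run/shared/lean/pub/lit-balaban/`), unit `lit-balaban-p21`
gen 4 (Phase-2 proof seat p21; `literature-prover-lit-balaban-p21-g4-0`); WHAT IS REPRODUCED = SKELETON rows **B5.Eq1.66**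
(members (1.65)/(1.66)) and **B5.Eq1.67** FOR THE `Δ_k` OF (1.19) (`B5Eq114Gauss.DeltaK`, row B5.Eq1.19 «proved p245722»),
i.e. the cell's interface row **IF2-25 / question Q-IF2-7** («no kernel statement joining (1.19) to (1.64)/(1.65) for the
(1.17) integral», INTERFACES.md §2): THIS FILE is the MEET of the tower side (seat p16 gen 2, `B5Eq165DeltaK`: `½⟨B, Δ_kB⟩
= min{S^η(A) : Q_kA = B}` for the Gaussian `Δ_k`, p248486) with the one-stroke side (seat p21 gen 3, `B5TowerOneStroke`:
the same minimum `= ½·formDk (L^k) M B̃`, p248294) — `IsLeast.unique` — followed by polarisation.  Owner r02, referee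
ref-4.  Kind «discharge of printed identities for typed objects»: NO definition, NO `Prop` fact is introduced.

WHAT IS PRINTED (verbatim, from the renders).
* p. 20 [PDF 4]: «It is easily seen that a composition of k transformations is given by ((ST)^k e^{−S})(B) = z^{(k)}∫dA
  δ(B − Q_kA)δ_Ax(Q_{k−1}A)·…·δ_Ax(A)e^{−S^η(A)}, (1.17) … We define ((ST)^k e^{−S})(B) = Z_{k,Ax} exp(−½⟨B, Δ_kB⟩).
  (1.19)» — typed `B5SectBStatements.Eq117/Eq119`, proved `B5Eq114Gauss.eq117_holds/eq119_holds` (d ≥ 2) with the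
  EXPLICIT symmetric operator `DeltaK L M k := (Wk L M k)† ∘ Wk L M k` and `rt17_gauss : rt17 k B = Z_k·exp(−S1 M (DeltaK k) B)`.
* p. 29 [PDF 13]: «((ST)^k e^{−S})(B) = Z_k exp(−½⟨∂H_kB, ∂H_kB⟩). (1.64) The action Δ_k is thus defined by ⟨B, Δ_kB⟩ =
  ⟨∂H_kB, ∂H_kB⟩. (1.65) Using formulas (1.60) or (1.63) we obtain the following expression ⟨B, Δ_kB⟩ = … =
  ½Σ_{μ,ν}(2π)^{−d}∫dp′ [ … ]⁻¹ |(∂₁B)~_{μν}(p′)|². (1.66) The function under the integral is bounded from below and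
  above by positive constants γ₀, γ₁ dependent on d only, so we have γ₀⟨∂₁B, ∂₁B⟩ ≤ ⟨B, Δ_kB⟩ ≤ γ₁⟨∂₁B, ∂₁B⟩. (1.67)»
* p. 34 [PDF 18]: «−QGQ*ω = B, −ω = (QGQ*)⁻¹B, (1.102) so finally we get the representation H_kB = GQ*(QGQ*)⁻¹B.
  (1.103)» — the tree's `Beta.FluctuationProjection.Hk`, equal to the (1.63) operator `B5Hk163Torus.HkOp`
  (`B5Hk163Form166.HkOp_eq_Hk`), and `Beta.BlockEffectiveAction.DelK_eq : DelK = (QGQ*)⁻¹ − a·1`.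

WHAT THIS FILE PROVES (kernel-checked, 0 sorry, axioms ⊆ {propext, Classical.choice, Quot.sound}; every `k`, every
`L ≥ 1`, every torus `M`, every `d` unless `2 ≤ d` is displayed; U = 1 as in the whole B5 lineage).
§1 THE MEET: `S1 M (DeltaK L M k) B = ½·formDk (L^k) M (cplx B)` (`S1_DeltaK_eq_half_formDk`), `⟨B, Δ_kB⟩ = formDk`
   (`inner_DeltaK_eq_formDk`; the third expression of (1.66), `B5Bounds167Lattice.formDk`), `= Re B̃ᴴ·DelK·B̃`
   (`inner_DeltaK_eq_DelK_form`, the (1.65) operator), `= η^d·½Σ|F^η(H_kB̃)|²` (`inner_DeltaK_eq_eta_cEnergy_HkOp`: (1.65)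
   «⟨B, Δ_kB⟩ = ⟨∂H_kB, ∂H_kB⟩» with the (1.21) weight, for the CLOSED-FORM minimiser `B5Hk163Torus.HkOp` of (1.63)), and
   `½⟨B, Δ_kB⟩ = S^η(H_kB̃ read on the tower)` (`S1_DeltaK_eq_actionEta_pullR_HkOp`).
§2 **(1.67) FOR THE GAUSSIAN `Δ_k`**: `(4/π²)^{d+2}⟨∂₁B,∂₁B⟩ ≤ ⟨B, Δ_kB⟩ ≤ (π²/4)^{2d+4}⟨∂₁B,∂₁B⟩` (`ineq167_DeltaK`, the
   literal (1.66) road, `B5Bounds167Lattice.ineq167`) and the sharper `⟨∂₁B,∂₁B⟩ ≤ ⟨B, Δ_kB⟩ ≤ (π²/4)^{d+2}⟨∂₁B,∂₁B⟩`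
   (`ineq167_DeltaK_sharp`, `B5Hk163Form166.ineq167_formDk_sharp`); **`B5.Bounds167` BY NAME for the family `k ↦ (Fld M,
   ⟨·, Δ_k·⟩, ⟨∂₁·,∂₁·⟩)`** — ONE pair `γ₀, γ₁` for all `k` («dependent on d only»), `bounds167_DeltaK`.
§3 POLARISATION ⇒ **THE OPERATOR IDENTITY `cplx (DeltaK L M k B) = DelK (L^k) hn M a ha *ᵥ cplx B`** (`cplx_DeltaK`):
   both `Δ_k` (symmetric, `B5Eq114Gauss.DeltaK_symm`) and the real matrix `Re DelK` (symmetric: `DelK` is Hermitian,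
   `Beta.BlockEffectiveAction.DelK_conjTranspose`, and REAL, `B6Cov2156TorusDelK.isReal_DelK`) are symmetric operators of
   `Fld M` with the same quadratic form (§1), hence equal (`LinearMap.IsSymmetric.inner_map_self_eq_zero`):
   `DeltaK_eq_toEuclideanLin`, `DeltaK_apply`, `DeltaK_apply_eq_re`, the bilinear identity `inner_DeltaK_eq_DelK_form₂`.
§4 CONSEQUENCES for the `Δ_k` of (1.19): the closed forms **`cplx (Δ_kB) = ((Q_kGQ_k*)⁻¹ − a·1)·B̃`** ((1.65)/(1.66) via
   (1.102)–(1.103); `cplx_DeltaK_eq_QGQ_inv_sub`) and `(Q_kGQ_k*)⁻¹B̃ = aB̃ + cplx (Δ_kB)` (`QGQ_inv_mulVec_cplx`), for EVERY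
   `a > 0`; `Δ_k` kills constant fields (`DeltaK_const`) and the longitudinal fields `∂λ₁` for EVERY `d`
   (`DeltaK_gradR_all_d`; p21 gen 3's `B5Eq120TowerGauge.DeltaK_gradR` needed `2 ≤ d`); and (1.19) WITH THE (1.65)/(1.66)
   OPERATOR: `((ST)^k e^{−S})(B) = Z·exp(−½ Re B̃ᴴ((Q_kGQ_k*)⁻¹ − a)B̃) = Z·exp(−½ formDk (L^k) M B̃)`, `Z > 0` (d ≥ 2;
   `iterST_eq_exp_DelK`, `iterST_eq_exp_formDk`).

HONEST SCOPE.  (i) Torus model, U = 1, as in `B5SectBStatements`/`B5Eq114Gauss` (the (1.17) integral over the tower of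
tori `towerM L M k`, identified with the one-stroke torus `fine (L^k) M` by `B5TowerOneStroke.towerE`).  (ii) The
constants of (1.67) are the package's (`(4/π²)^{d+2}`, `(π²/4)^{2d+4}`, resp. `1`, `(π²/4)^{d+2}`); Bałaban prints none.
(iii) `Beta.BlockEffectiveAction.DelK` carries the parameters `(hn : 1 ≤ n) (a) (ha : 0 < a)` of `G = G_k(a)`; every
statement here holds for every admissible `a` (the operator does not depend on it, `DelK_indep`; here this is visible
as the `a`-free left member `DeltaK L M k`).  (iv) NOT claimed here: the Landau-gauge characterisation of the
transported minimiser (that `pullR (H_kB̃)` is THE member of p16's `landauMin k B` — it attains the minimum over the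
whole fibre, `B5TowerOneStroke.actionEta_pullR_HkOp`, but its membership in p16's `Lan k` is not transported here);
anything on the infinite lattice; background fields.  Value = kernel certificate that three typed presentations of
Bałaban's `Δ_k` — the Gaussian DEFINITION (1.19), the variational/closed form (1.65)/(1.103), the momentum form (1.66) —
are ONE operator; NOT summit progress.
-/

open scoped BigOperators Matrix InnerProductSpace ComplexConjugate

namespace Literature.MathematicalPhysics.QuantumFieldTheory.Balaban1983to89.B5Eq166GaussDeltaK

open B5SectBStatements B5Eq114Gauss
open B5Prop11Plancherel (Tor fine)
open B5TowerOneStroke (towerE trC pullR isLeast_actionEta eta_pow_mul_pow cEnergy_HkOp actionEta_pullR_HkOp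
  Qk_pullR_HkOp)
open B5Eq165DeltaK (isLeast_actionEta_fibre)
open B5Eq115GaugeChain (gradR cplx_gradR)
open B5Bounds167Lattice (formDk d1Sq ineq167)
open B5Hk163Form166 (DelK_form_eq_formDk DelK_form_re_eq_formDk ineq167_formDk_sharp)
open Beta.BlockEffectiveAction (DelK DelK_eq DelK_conjTranspose DelK_mulVec_const DelK_mulVec_grad QGQ_inv_eq)
open Beta.FluctuationProjection (QGQ Hk)
open Beta.Ineq167OperatorUpper (gamma1)
open B5RealFields (IsReal reM)
open B6Cov2156TorusDelK (isReal_DelK)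
open B5Hk163Torus (HkOp)
open B5Hk164Transl (cEnergy)
open B5Action121 (GradOp)

noncomputable section

variable {d : ℕ} (L : ℕ) (M : Fin d → ℕ) [NeZero L] [hM : ∀ μ, NeZero (M μ)]

/-! ## §1  The meet: `½⟨B, Δ_kB⟩ = ½·formDk (L^k) M B̃` for the `Δ_k` of (1.19) -/

/-- **THE MEET (IF2-25)**: for the Gaussian covariance `Δ_k = W_k†W_k` DEFINED by the k-fold integral (1.17)/(1.19),
`½⟨B, Δ_kB⟩ = ½·formDk (L^k) M B̃` — the (1.66) form of the tree — for every `k` and every real unit-lattice field `B`: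
both members are the least value of `S^η` over the block-spin fibre `{A : Q_kA = B}` (p16's `isLeast_actionEta_fibre`,
p21's `isLeast_actionEta`). [cite: Balaban1984PropagatorsI, (1.65)–(1.66) p.29] -/
theorem S1_DeltaK_eq_half_formDk (k : ℕ) (B : Fld M) :
    S1 M (DeltaK L M k) B = 1 / 2 * formDk (L ^ k) M (cplx B) :=
  (isLeast_actionEta_fibre L M k B).unique (isLeast_actionEta L M k B)

/-- **`⟨B, Δ_kB⟩ = formDk (L^k) M B̃`**: the quadratic form of the `Δ_k` of (1.19) IS the third expression of (1.66).
[cite: Balaban1984PropagatorsI, (1.66) p.29] -/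
theorem inner_DeltaK_eq_formDk (k : ℕ) (B : Fld M) :
    ⟪B, DeltaK L M k B⟫_ℝ = formDk (L ^ k) M (cplx B) := by
  have h := S1_DeltaK_eq_half_formDk L M k B
  rw [S1] at h
  linarith

/-- `‖W_kB‖² = formDk (L^k) M B̃` (the whitened constraint map of `B5Eq114Gauss`). [cite: Balaban1984PropagatorsI, (1.19) p.20, (1.66) p.29] -/
theorem norm_Wk_sq_eq_formDk (k : ℕ) (B : Fld M) : ‖Wk L M k B‖ ^ 2 = formDk (L ^ k) M (cplx B) := by
  rw [← inner_DeltaK, inner_DeltaK_eq_formDk]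

/-- **`⟨B, Δ_kB⟩ = Re B̃ᴴ·DelK·B̃`**: the quadratic form of the `Δ_k` of (1.19) is that of the (1.65) operator
`Beta.BlockEffectiveAction.DelK (L^k) = n^{−d}H_kᴴ(½curlᴴcurl)H_k` (every admissible `a`).
[cite: Balaban1984PropagatorsI, (1.65) p.29] -/
theorem inner_DeltaK_eq_DelK_form (k : ℕ) (hn : 1 ≤ L ^ k) (a : ℝ) (ha : 0 < a) (B : Fld M) :
    ⟪B, DeltaK L M k B⟫_ℝ = (star (cplx B) ⬝ᵥ (DelK (L ^ k) hn M a ha *ᵥ cplx B)).re := by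
  rw [DelK_form_re_eq_formDk, inner_DeltaK_eq_formDk]

/-- the same in `ℂ`: `(⟨B, Δ_kB⟩ : ℂ) = B̃ᴴ·DelK·B̃`. [cite: Balaban1984PropagatorsI, (1.65) p.29] -/
theorem inner_DeltaK_eq_DelK_form' (k : ℕ) (hn : 1 ≤ L ^ k) (a : ℝ) (ha : 0 < a) (B : Fld M) :
    ((⟪B, DeltaK L M k B⟫_ℝ : ℝ) : ℂ) = star (cplx B) ⬝ᵥ (DelK (L ^ k) hn M a ha *ᵥ cplx B) := by
  rw [DelK_form_eq_formDk, inner_DeltaK_eq_formDk]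

/-- **(1.65) «⟨B, Δ_kB⟩ = ⟨∂H_kB, ∂H_kB⟩»** for the `Δ_k` of (1.19) and the closed-form minimiser `H_k = B5Hk163Torus.HkOp
(L^k) M` of (1.63): `⟨B, Δ_kB⟩ = η^d·cEnergy (H_kB̃)` (`cEnergy A = ½Σ_{x,μ,ν}|F^η_{μν}[A](x)|²`, the (1.21) weight `η^d`).
[cite: Balaban1984PropagatorsI, (1.65) p.29, (1.21) p.21] -/
theorem inner_DeltaK_eq_eta_cEnergy_HkOp (k : ℕ) (B : Fld M) :
    ⟪B, DeltaK L M k B⟫_ℝ = eta L k ^ d * cEnergy (L ^ k) M (HkOp (L ^ k) M *ᵥ cplx B) := by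
  rw [cEnergy_HkOp, ← mul_assoc, eta_pow_mul_pow, one_mul, inner_DeltaK_eq_formDk]

/-- **`½⟨B, Δ_kB⟩ = S^η(H_kB̃)`**: the Gaussian exponent of (1.19) is the tower action of (the real part of) the
closed-form minimiser `H_kB̃` read on level `k` (`B5TowerOneStroke.pullR`), which lies on the fibre `Q_kA = B`.
[cite: Balaban1984PropagatorsI, (1.64)–(1.65) p.29] -/
theorem S1_DeltaK_eq_actionEta_pullR_HkOp (k : ℕ) (B : Fld M) :
    S1 M (DeltaK L M k) B = actionEta L M k (pullR L M k (HkOp (L ^ k) M *ᵥ cplx B)) := by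
  rw [actionEta_pullR_HkOp, S1_DeltaK_eq_half_formDk]

/-- hence `pullR (H_kB̃)` MINIMISES `S^η` on the fibre `{Q_kA = B}` with value `½⟨B, Δ_kB⟩` (the Gaussian `Δ_k`).
[cite: Balaban1984PropagatorsI, p.29 «H_kB is a minimum of ½⟨∂A, ∂A⟩ on the hyperplane», (1.65) p.29] -/
theorem isMinOn_actionEta_pullR_HkOp (k : ℕ) (B : Fld M) :
    IsMinOn (actionEta L M k) {A | Qk L M k A = B} (pullR L M k (HkOp (L ^ k) M *ᵥ cplx B)) := by
  intro A hA
  rw [Set.mem_setOf_eq, ← S1_DeltaK_eq_actionEta_pullR_HkOp]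
  exact (isLeast_actionEta_fibre L M k B).2 ⟨A, hA, rfl⟩

/-! ## §2  (1.67) for the `Δ_k` of (1.19), and `B5.Bounds167` by name -/

/-- **(1.67) FOR THE GAUSSIAN `Δ_k`** (the literal (1.66) road, constants of `B5Bounds167Lattice.ineq167`):
`(4/π²)^{d+2}⟨∂₁B,∂₁B⟩ ≤ ⟨B, Δ_kB⟩ ≤ (π²/4)^{2d+4}⟨∂₁B,∂₁B⟩` for every `k` and every `B`
(`⟨∂₁B,∂₁B⟩ = B5Bounds167Lattice.d1Sq M B̃`). [cite: Balaban1984PropagatorsI, (1.67) p.29] -/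
theorem ineq167_DeltaK (k : ℕ) (B : Fld M) :
    (4 / Real.pi ^ 2) ^ (d + 2) * d1Sq M (cplx B) ≤ ⟪B, DeltaK L M k B⟫_ℝ
      ∧ ⟪B, DeltaK L M k B⟫_ℝ ≤ (Real.pi ^ 2 / 4) ^ (2 * d + 4) * d1Sq M (cplx B) := by
  rw [inner_DeltaK_eq_formDk]
  exact ineq167 (L ^ k) M (Nat.one_le_pow k L (Nat.pos_of_ne_zero (NeZero.ne L))) (cplx B)

/-- **(1.67) FOR THE GAUSSIAN `Δ_k`, sharper constants** `γ₀ = 1`, `γ₁ = (π²/4)^{d+2}` (the β cell's operator route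
`B5Hk163Form166.ineq167_formDk_sharp`): `⟨∂₁B,∂₁B⟩ ≤ ⟨B, Δ_kB⟩ ≤ (π²/4)^{d+2}⟨∂₁B,∂₁B⟩`.
[cite: Balaban1984PropagatorsI, (1.67) p.29] -/
theorem ineq167_DeltaK_sharp (k : ℕ) (B : Fld M) :
    d1Sq M (cplx B) ≤ ⟪B, DeltaK L M k B⟫_ℝ ∧ ⟪B, DeltaK L M k B⟫_ℝ ≤ gamma1 d * d1Sq M (cplx B) := by
  rw [inner_DeltaK_eq_formDk]
  have hn : 1 ≤ L ^ k := Nat.one_le_pow k L (Nat.pos_of_ne_zero (NeZero.ne L))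
  haveI : NeZero (L ^ k) := ⟨by omega⟩
  exact ineq167_formDk_sharp (L ^ k) hn M (cplx B)

/-- the same for the Gaussian exponent `S₁ = ½⟨B, Δ_kB⟩`: `½⟨∂₁B,∂₁B⟩ ≤ S1 ≤ ½γ₁⟨∂₁B,∂₁B⟩`.
[cite: Balaban1984PropagatorsI, (1.67) p.29, (1.19) p.20] -/
theorem ineq167_S1_DeltaK (k : ℕ) (B : Fld M) :
    1 / 2 * d1Sq M (cplx B) ≤ S1 M (DeltaK L M k) B ∧ S1 M (DeltaK L M k) B ≤ 1 / 2 * (gamma1 d * d1Sq M (cplx B)) := by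
  have h := ineq167_DeltaK_sharp L M k B
  rw [S1]
  constructor <;> linarith [h.1, h.2]

/-- **`B5.Bounds167` BY NAME for the Gaussian covariances of (1.19)**: for the family `k ↦ (Fld M, ⟨·, Δ_k·⟩, ⟨∂₁·,∂₁·⟩)`
there is ONE pair `γ₀, γ₁ > 0` («dependent on d only» — in particular independent of `k`) with (1.67) for every `k`
and every `B` (the abstract (1.67) of `B5.lean`, consumed by `B6.h2118_of_B5`). [cite: Balaban1984PropagatorsI, (1.67) p.29] -/
theorem bounds167_DeltaK :
    B5.Bounds167 (fun k : ℕ =>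
      ({ Cfg := Fld M, formΔk := fun B => ⟪B, DeltaK L M k B⟫_ℝ, d1Sq := fun B => d1Sq M (cplx B) } : B5.FormData)) := by
  refine ⟨1, gamma1 d, one_pos, Beta.Ineq167OperatorUpper.gamma1_pos d, fun k B => ?_⟩
  have h := ineq167_DeltaK_sharp L M k B
  exact ⟨by rw [one_mul]; exact h.1, h.2⟩

/-! ## §3  Polarisation: the `Δ_k` of (1.19) IS the (1.65) operator, as operators -/

section Polar

variable {ι : Type*} [Fintype ι]

omit [NeZero L] hM in
/-- on real vectors a real matrix has the real quadratic form `Re ũᴴ·D·ṽ = u·(Re D)v`. [folklore] -/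
private theorem re_star_cplx_dotProduct_mulVec {D : Matrix ι ι ℂ} (hD : IsReal D) (u v : ι → ℝ) :
    (star (B5RealFields.cplx u) ⬝ᵥ (D *ᵥ B5RealFields.cplx v)).re = u ⬝ᵥ (reM D *ᵥ v) := by
  rw [← hD.cplx_mulVec, B5RealFields.star_cplx_dotProduct, Complex.ofReal_re]

omit [NeZero L] hM in
/-- the two complexifications of the package agree on `Fld`: `B5SectBStatements.cplx B = B5RealFields.cplx ⇑B`. [folklore] -/
private theorem cplx_eq_cplx {N : Fin d → ℕ} (B : Fld N) : cplx B = B5RealFields.cplx (WithLp.ofLp B) := rfl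

omit [NeZero L] in
/-- the Euclidean scalar product of `Fld` is the dot product of the coordinate vectors. [folklore] -/
private theorem inner_eq_dotProduct (B B' : Fld M) : ⟪B, B'⟫_ℝ = WithLp.ofLp B ⬝ᵥ WithLp.ofLp B' := by
  simp only [PiLp.inner_apply, RCLike.inner_apply, conj_trivial, dotProduct]
  exact Finset.sum_congr rfl fun i _ => mul_comm _ _

omit [NeZero L] hM in
/-- `cplx 0 = 0`. [folklore] -/
private theorem cplx_zero : cplx (0 : Fld M) = 0 := by
  funext i
  simp [cplx]

omit [NeZero L] hM in
/-- a real symmetric matrix acts as a symmetric operator of the Euclidean space. [folklore] -/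
private theorem isSymmetric_toEuclideanLin_of_transpose [DecidableEq ι] {A : Matrix ι ι ℝ} (hA : Aᵀ = A) :
    (Matrix.toEuclideanLin A).IsSymmetric := by
  rw [Matrix.isSymmetric_toEuclideanLin_iff]
  show Aᴴ = A
  rw [Matrix.conjTranspose_eq_transpose_of_trivial, hA]

/-- `Re DelK` is a symmetric real matrix (`DelK` is Hermitian). [cite: Balaban1984PropagatorsI, (1.65) p.29] -/
theorem reM_DelK_transpose (k : ℕ) (hn : 1 ≤ L ^ k) (a : ℝ) (ha : 0 < a) :
    (reM (DelK (L ^ k) hn M a ha))ᵀ = reM (DelK (L ^ k) hn M a ha) := by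
  haveI : NeZero (L ^ k) := ⟨by omega⟩
  exact B5RealFields.reM_transpose_of_isHermitian (DelK_conjTranspose (L ^ k) hn M a ha)

/-- `Δ_k` of (1.19) is a symmetric operator of `Fld M`. [cite: Balaban1984PropagatorsI, (1.19) p.20] -/
theorem DeltaK_isSymmetric (k : ℕ) : (DeltaK L M k).IsSymmetric := fun B B' => DeltaK_symm L M k B B'

/-- **THE `Δ_k` OF (1.19) IS THE REAL OPERATOR OF THE MATRIX `Re DelK (L^k)`** (two symmetric operators of `Fld M` with the
same quadratic form). [cite: Balaban1984PropagatorsI, (1.65) p.29, (1.19) p.20] -/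
theorem DeltaK_eq_toEuclideanLin (k : ℕ) (hn : 1 ≤ L ^ k) (a : ℝ) (ha : 0 < a) :
    DeltaK L M k = Matrix.toEuclideanLin (reM (DelK (L ^ k) hn M a ha)) := by
  haveI : NeZero (L ^ k) := ⟨by omega⟩
  set T := Matrix.toEuclideanLin (𝕜 := ℝ) (reM (DelK (L ^ k) hn M a ha)) with hT
  have hsymm : (DeltaK L M k - T).IsSymmetric :=
    (DeltaK_isSymmetric L M k).sub (isSymmetric_toEuclideanLin_of_transpose (reM_DelK_transpose L M k hn a ha))
  have hzero : ∀ B : Fld M, ⟪(DeltaK L M k - T) B, B⟫_ℝ = 0 := by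
    intro B
    rw [LinearMap.sub_apply, inner_sub_left, real_inner_comm, inner_DeltaK_eq_DelK_form L M k hn a ha, cplx_eq_cplx,
      re_star_cplx_dotProduct_mulVec (isReal_DelK (L ^ k) hn M a ha), inner_eq_dotProduct M, hT, Matrix.toLpLin_apply,
      WithLp.ofLp_toLp, dotProduct_comm, sub_self]
  exact sub_eq_zero.1 (hsymm.inner_map_self_eq_zero.1 hzero)

/-- coordinates: `Δ_kB = (Re DelK)·B`. [cite: Balaban1984PropagatorsI, (1.65) p.29] -/
theorem DeltaK_apply (k : ℕ) (hn : 1 ≤ L ^ k) (a : ℝ) (ha : 0 < a) (B : Fld M) :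
    DeltaK L M k B = WithLp.toLp 2 (reM (DelK (L ^ k) hn M a ha) *ᵥ WithLp.ofLp B) := by
  rw [DeltaK_eq_toEuclideanLin L M k hn a ha, Matrix.toLpLin_apply]

/-- **THE BRIDGE (IF2-25): `cplx (Δ_kB) = DelK (L^k) · B̃`** — the Gaussian covariance DEFINED by the k-fold
renormalization integral (1.17)/(1.19) (`B5Eq114Gauss.DeltaK`) IS the (1.65) operator `n^{−d}H_kᴴ(∂*∂)H_k` of the
tree (`Beta.BlockEffectiveAction.DelK`, ≡ the substrate's `BalabanHardMinimizer.DeltaK` by `DeltaK_eq_DelK`), for every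
`k`, every real field `B`, every admissible `a`. [cite: Balaban1984PropagatorsI, (1.65) p.29, (1.19) p.20] -/
theorem cplx_DeltaK (k : ℕ) (hn : 1 ≤ L ^ k) (a : ℝ) (ha : 0 < a) (B : Fld M) :
    cplx (DeltaK L M k B) = DelK (L ^ k) hn M a ha *ᵥ cplx B := by
  haveI : NeZero (L ^ k) := ⟨by omega⟩
  rw [DeltaK_apply L M k hn a ha, cplx_eq_cplx, cplx_eq_cplx, WithLp.ofLp_toLp,
    (isReal_DelK (L ^ k) hn M a ha).cplx_mulVec]

/-- coordinates: `(Δ_kB)_b = Re (DelK·B̃)_b` (and `Im (DelK·B̃)_b = 0`). [cite: Balaban1984PropagatorsI, (1.65) p.29] -/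
theorem DeltaK_apply_eq_re (k : ℕ) (hn : 1 ≤ L ^ k) (a : ℝ) (ha : 0 < a) (B : Fld M) (b : Tor M × Fin d) :
    DeltaK L M k B b = ((DelK (L ^ k) hn M a ha *ᵥ cplx B) b).re := by
  rw [← cplx_DeltaK L M k hn a ha B]
  rfl

/-- the imaginary parts vanish: `DelK·B̃` is a real vector. [cite: Balaban1984PropagatorsI, (1.65) p.29] -/
theorem im_DelK_mulVec_cplx (k : ℕ) (hn : 1 ≤ L ^ k) (a : ℝ) (ha : 0 < a) (B : Fld M) (b : Tor M × Fin d) :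
    ((DelK (L ^ k) hn M a ha *ᵥ cplx B) b).im = 0 := by
  rw [← cplx_DeltaK L M k hn a ha B]
  exact Complex.ofReal_im _

/-- the matrix of `Δ_k` in the bond basis of `Fld M` is `Re DelK (L^k)` (`Matrix.toEuclideanLin` is a linear equivalence).
[cite: Balaban1984PropagatorsI, (1.65) p.29] -/
theorem toEuclideanLin_symm_DeltaK (k : ℕ) (hn : 1 ≤ L ^ k) (a : ℝ) (ha : 0 < a) :
    (Matrix.toEuclideanLin (𝕜 := ℝ)).symm (DeltaK L M k) = reM (DelK (L ^ k) hn M a ha) := by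
  rw [DeltaK_eq_toEuclideanLin L M k hn a ha, LinearEquiv.symm_apply_apply]

/-- **the bilinear identity** `⟨B, Δ_kB′⟩ = Re B̃ᴴ·DelK·B̃′` (polarised (1.65) for the Gaussian `Δ_k`).
[cite: Balaban1984PropagatorsI, (1.65) p.29] -/
theorem inner_DeltaK_eq_DelK_form₂ (k : ℕ) (hn : 1 ≤ L ^ k) (a : ℝ) (ha : 0 < a) (B B' : Fld M) :
    ⟪B, DeltaK L M k B'⟫_ℝ = (star (cplx B) ⬝ᵥ (DelK (L ^ k) hn M a ha *ᵥ cplx B')).re := by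
  rw [← cplx_DeltaK L M k hn a ha B', cplx_eq_cplx, cplx_eq_cplx, B5RealFields.star_cplx_dotProduct, Complex.ofReal_re,
    inner_eq_dotProduct M]

end Polar

/-! ## §4  Consequences for the `Δ_k` of (1.19): the closed forms (1.65)/(1.66), constants, gauge directions, (1.19) -/

/-- **(1.65)/(1.66) CLOSED FORM for the `Δ_k` of (1.19): `cplx (Δ_kB) = ((Q_kGQ_k*)⁻¹ − a·1)·B̃`** (`G = G_k(a) = Δ_a⁻¹`,
(1.102)–(1.103); `Beta.BlockEffectiveAction.DelK_eq`), every `a > 0`. [cite: Balaban1984PropagatorsI, (1.65) p.29, (1.102)–(1.103) p.34] -/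
theorem cplx_DeltaK_eq_QGQ_inv_sub (k : ℕ) (hn : 1 ≤ L ^ k) (a : ℝ) (ha : 0 < a) (B : Fld M) :
    cplx (DeltaK L M k B)
      = ((QGQ (L ^ k) hn M a ha)⁻¹ - (a : ℂ) • (1 : Matrix (Tor M × Fin d) (Tor M × Fin d) ℂ)) *ᵥ cplx B := by
  haveI : NeZero (L ^ k) := ⟨by omega⟩
  rw [cplx_DeltaK L M k hn a ha, DelK_eq]

/-- **`(Q_kGQ_k*)⁻¹B̃ = a·B̃ + cplx (Δ_kB)`** for the `Δ_k` of (1.19) («−ω = (QGQ*)⁻¹B», (1.102)).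
[cite: Balaban1984PropagatorsI, (1.102) p.34, (1.65) p.29] -/
theorem QGQ_inv_mulVec_cplx (k : ℕ) (hn : 1 ≤ L ^ k) (a : ℝ) (ha : 0 < a) (B : Fld M) :
    (QGQ (L ^ k) hn M a ha)⁻¹ *ᵥ cplx B = (a : ℂ) • cplx B + cplx (DeltaK L M k B) := by
  haveI : NeZero (L ^ k) := ⟨by omega⟩
  rw [cplx_DeltaK L M k hn a ha, QGQ_inv_eq, Matrix.add_mulVec, Matrix.smul_mulVec, Matrix.one_mulVec]

/-- **(1.65) AS AN OPERATOR SANDWICH for the `Δ_k` of (1.19)**: `cplx (Δ_kB) = n^{−d}·H_kᴴ(½curlᴴcurl)H_k·B̃`,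
`H_k = GQ*(QGQ*)⁻¹` (1.103) — «⟨B, Δ_kB⟩ = ⟨∂H_kB, ∂H_kB⟩» with `∂*∂ = ½curlᴴcurl` on vector fields and the weight
`η^d = n^{−d}` of (1.21). [cite: Balaban1984PropagatorsI, (1.65) p.29, (1.103) p.34] -/
theorem cplx_DeltaK_eq_Hk_sandwich (k : ℕ) (hn : 1 ≤ L ^ k) (a : ℝ) (ha : 0 < a) (B : Fld M) :
    cplx (DeltaK L M k B)
      = ((((L ^ k : ℕ) : ℂ) ^ d)⁻¹ • ((Hk (L ^ k) hn M a ha)ᴴ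
          * ((1 / 2 : ℂ) • ((B5Action121.CurlOp (fine (L ^ k) M) ((L ^ k : ℕ) : ℂ))ᴴ
              * B5Action121.CurlOp (fine (L ^ k) M) ((L ^ k : ℕ) : ℂ))) * Hk (L ^ k) hn M a ha)) *ᵥ cplx B := by
  rw [cplx_DeltaK L M k hn a ha]
  rfl

/-- **`Δ_k` of (1.19) kills the constant fields** (`B_μ(y) = c_μ`; the `p′ = 0` mode of (1.66) carries `(∂₁B)~(0) = 0`).
[cite: Balaban1984PropagatorsI, (1.66) p.29] -/
theorem DeltaK_const (k : ℕ) (c : Fin d → ℝ) :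
    DeltaK L M k (WithLp.toLp 2 fun q : Tor M × Fin d => c q.2) = 0 := by
  have hn : 1 ≤ L ^ k := Nat.one_le_pow k L (Nat.pos_of_ne_zero (NeZero.ne L))
  haveI : NeZero (L ^ k) := ⟨by omega⟩
  apply cplx_injective
  have hc : cplx (WithLp.toLp 2 fun q : Tor M × Fin d => c q.2 : Fld M) = fun q : Tor M × Fin d => ((c q.2 : ℝ) : ℂ) := rfl
  have h0 := DelK_mulVec_const (L ^ k) hn M 1 one_pos (fun μ => ((c μ : ℝ) : ℂ))
  rw [cplx_DeltaK L M k hn 1 one_pos, hc, cplx_zero]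
  exact h0

/-- **`Δ_k` of (1.19) kills the longitudinal fields `∂λ₁` for EVERY `d`** (the (1.15)/(1.20) gauge directions; p21 gen 3's
`B5Eq120TowerGauge.DeltaK_gradR` obtained this from the integral for `2 ≤ d`): `Δ_k(∂λ₁) = 0`.
[cite: Balaban1984PropagatorsI, (1.20) p.20, (1.15) p.19] -/
theorem DeltaK_gradR_all_d (k : ℕ) (l₁ : Scl M) : DeltaK L M k (gradR l₁) = 0 := by
  have hn : 1 ≤ L ^ k := Nat.one_le_pow k L (Nat.pos_of_ne_zero (NeZero.ne L))
  haveI : NeZero (L ^ k) := ⟨by omega⟩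
  apply cplx_injective
  rw [cplx_DeltaK L M k hn 1 one_pos, cplx_gradR, DelK_mulVec_grad, cplx_zero]

/-- hence `⟨B − ∂λ₁, Δ_k(B − ∂λ₁)⟩ = ⟨B, Δ_kB⟩` for EVERY `d` (gauge invariance of the Gaussian exponent of (1.19)).
[cite: Balaban1984PropagatorsI, (1.15) p.19, (1.20) p.20] -/
theorem inner_DeltaK_gauge_all_d (k : ℕ) (B : Fld M) (l₁ : Scl M) :
    ⟪B - gradR l₁, DeltaK L M k (B - gradR l₁)⟫_ℝ = ⟪B, DeltaK L M k B⟫_ℝ := by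
  have h0 : ⟪gradR l₁, DeltaK L M k B⟫_ℝ = 0 := by
    rw [← DeltaK_symm, DeltaK_gradR_all_d, inner_zero_left]
  rw [map_sub, DeltaK_gradR_all_d, sub_zero, inner_sub_left, h0, sub_zero]

/-- **(1.19) WITH THE (1.65) OPERATOR** (d ≥ 2): `((ST)^k e^{−S})(B) = Z·exp(−½ Re B̃ᴴ·DelK (L^k)·B̃)`, `Z > 0` — the
k-fold renormalization image of `e^{−S}` is the centred Gaussian whose covariance operator is `(Q_kGQ_k*)⁻¹ − a`.
[cite: Balaban1984PropagatorsI, (1.19) p.20, (1.64)–(1.65) p.29] -/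
theorem iterST_eq_exp_DelK (hd : 2 ≤ d) (k : ℕ) (hn : 1 ≤ L ^ k) (a : ℝ) (ha : 0 < a) :
    ∃ Z : ℝ, 0 < Z ∧ ∀ B : Fld M, iterST L M k (fun A => Real.exp (-action1 A)) B
      = Z * Real.exp (-(1 / 2 * (star (cplx B) ⬝ᵥ (DelK (L ^ k) hn M a ha *ᵥ cplx B)).re)) := by
  obtain ⟨z, hz, h⟩ := eq117_holds L M hd k
  refine ⟨z * Zk L M k, mul_pos hz (Zk_pos L M hd k), fun B => ?_⟩
  rw [h B, rt17_gauss, mul_assoc, S1, inner_DeltaK_eq_DelK_form L M k hn a ha]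

/-- **(1.19) WITH THE (1.66) FORM** (d ≥ 2): `((ST)^k e^{−S})(B) = Z·exp(−½·formDk (L^k) M B̃)`, `Z > 0`.
[cite: Balaban1984PropagatorsI, (1.19) p.20, (1.66) p.29] -/
theorem iterST_eq_exp_formDk (hd : 2 ≤ d) (k : ℕ) :
    ∃ Z : ℝ, 0 < Z ∧ ∀ B : Fld M, iterST L M k (fun A => Real.exp (-action1 A)) B
      = Z * Real.exp (-(1 / 2 * formDk (L ^ k) M (cplx B))) := by
  obtain ⟨z, hz, h⟩ := eq117_holds L M hd k
  refine ⟨z * Zk L M k, mul_pos hz (Zk_pos L M hd k), fun B => ?_⟩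
  rw [h B, rt17_gauss, mul_assoc, S1_DeltaK_eq_half_formDk]

/-- and «Z_{k,Ax}exp(−½⟨B, Δ_kB⟩)» has the (1.67) Gaussian sandwich: `Z·e^{−½γ₁⟨∂₁B,∂₁B⟩} ≤ ((ST)^k e^{−S})(B) ≤
Z·e^{−½⟨∂₁B,∂₁B⟩}` (d ≥ 2). [cite: Balaban1984PropagatorsI, (1.67) p.29, (1.19) p.20] -/
theorem iterST_sandwich (hd : 2 ≤ d) (k : ℕ) :
    ∃ Z : ℝ, 0 < Z ∧ ∀ B : Fld M,
      Z * Real.exp (-(1 / 2 * (gamma1 d * d1Sq M (cplx B)))) ≤ iterST L M k (fun A => Real.exp (-action1 A)) B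
        ∧ iterST L M k (fun A => Real.exp (-action1 A)) B ≤ Z * Real.exp (-(1 / 2 * d1Sq M (cplx B))) := by
  obtain ⟨z, hz, h⟩ := eq117_holds L M hd k
  refine ⟨z * Zk L M k, mul_pos hz (Zk_pos L M hd k), fun B => ?_⟩
  have hZ : 0 < z * Zk L M k := mul_pos hz (Zk_pos L M hd k)
  have h67 := ineq167_S1_DeltaK L M k B
  have e1 : iterST L M k (fun A => Real.exp (-action1 A)) B = (z * Zk L M k) * Real.exp (-S1 M (DeltaK L M k) B) := by
    rw [h B, rt17_gauss, mul_assoc]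
  rw [e1]
  constructor
  · exact mul_le_mul_of_nonneg_left (Real.exp_le_exp.2 (by linarith [h67.2])) hZ.le
  · exact mul_le_mul_of_nonneg_left (Real.exp_le_exp.2 (by linarith [h67.1])) hZ.le

end

end Literature.MathematicalPhysics.QuantumFieldTheory.Balaban1983to89.B5Eq166GaussDeltaK
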